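import Summits.MatrixMultiplication.MatrixMultiplication.Theorems.AbelianSTPPCensusShapeCertSemantics

/-!
# Abelian STPP census — soundness of the `ShapeCert` checker for crux `ShapeExclusionTE` (part 3: buckets, decoration, universe)

Cell mm-stpp, rung F-M1, route `AbelianSTPPCensus`; implementation B (seat eng-2).  The checker is defined in
`…Theorems.AbelianSTPPCensusShapeCertDefs`; the files `…ShapeCertSemantics` (shape arithmetic, the hereditary
sieve system `AdmM` on multisets of shapes, heredity), `…ShapeCertBudgets` (prefix aggregates versus the tail of
an admissible family), `…ShapeCertUniverse` (volume buckets, the decorated candidate list, completeness of the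
universe) and `…ShapeCertSearch` (the continuation bound, completeness of the admissibility test, the search
induction, `check_sound`) prove: `check M = true` ⇒ every `AdmM`-admissible shape multiset inside the universe
with integer gain `> 10⁶·M` contains a registered residual sub-multiset.
-/

set_option linter.dupNamespace false -- `MatrixMultiplication.MatrixMultiplication` (summit = problem, D-0017)
set_option autoImplicit false


namespace Summit.MatrixMultiplication.MatrixMultiplication.Theorems.ShapeCert

open Multiset

section caps
/-! ### Volume buckets -/

/-- `V² < (n+1)²` gives `V ≤ n` -/
theorem le_of_sq_lt {V n : ℕ} (h : V * V < (n + 1) * (n + 1)) : V ≤ n :=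
  Nat.lt_succ_iff.mp (Nat.mul_self_lt_mul_self_iff.mp h)

/-- buckets are downward closed in the volume -/
theorem capOK_of_le {k V W : ℕ} (h : V ≤ W) (hk : capOK k W = true) : capOK k V = true := by
  unfold capOK at *; simp only [Bool.or_eq_true, decide_eq_true_eq] at *
  rcases hk with hk | hk
  · exact Or.inl hk
  · exact Or.inr (h.trans hk)

/-- bucket `7` and above admit everything -/
theorem capOK_seven_le {k V : ℕ} (hk : 7 ≤ k) : capOK k V = true := by
  unfold capOK; simp [hk]

/-- `bucketOf v` admits `v` -/
theorem capOK_bucketOf (v : ℕ) : capOK (bucketOf v) v = true := by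
  unfold bucketOf capOK
  split_ifs <;> simp only [Bool.or_eq_true, decide_eq_true_eq] <;> first | (right; omega) | (left; rfl)

/-- `kU q` admits every volume with `27V² ≤ q³` -/
theorem capOK_kU {q V : ℕ} (h : 27 * (V * V) ≤ q ^ 3) : capOK (kU q) V = true := by
  unfold kU capOK
  split_ifs <;> simp only [Bool.or_eq_true, decide_eq_true_eq] <;>
    first | (left; rfl) | (right; apply le_of_sq_lt; norm_num; omega)

/-- `kR r` admits every volume with `4V ≤ r²` -/
theorem capOK_kR {r V : ℕ} (h : 4 * V ≤ r * r) : capOK (kR r) V = true := by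
  unfold kR capOK
  split_ifs <;> simp only [Bool.or_eq_true, decide_eq_true_eq] <;>
    first | (left; rfl) | (right; norm_num; omega)

/-- the smallest of three admitting buckets admits -/
theorem capOK_min3 {k1 k2 k3 V : ℕ} (h1 : capOK k1 V = true) (h2 : capOK k2 V = true)
    (h3 : capOK k3 V = true) : capOK (min k1 (min k2 k3)) V = true := by
  rcases min_choice k2 k3 with h | h <;> rw [h] <;> rcases min_choice k1 _ with h' | h' <;> rw [h'] <;>
    assumption

/-- buckets beyond `7` coincide with `7` -/
theorem capOK_min7 (k V : ℕ) : capOK (min k 7) V = capOK k V := by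
  rcases Nat.lt_or_ge k 7 with hk | hk
  · rw [min_eq_left hk.le]
  · rw [min_eq_right hk, capOK_seven_le hk, capOK_seven_le le_rfl]

/-- components beyond `7` read the unrestricted bucket -/
theorem B8.get_ge7 (B : B8) {k : ℕ} (hk : 7 ≤ k) : B.get k = B.b7 := by
  obtain ⟨j, rfl⟩ := Nat.exists_eq_add_of_le hk
  rw [Nat.add_comm]; rfl

/-- `selOf k` is the `k`-th component -/
theorem selOf_eq (k : ℕ) (B : B8) : selOf k B = B.get k := by
  match k with
  | 0 | 1 | 2 | 3 | 4 | 5 | 6 => rfl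
  | _ + 7 => rfl

end caps

section decoration
/-! ### The decorated candidate list -/

/-- the bucket vector at the head of `sufMax (s :: rest)` -/
def bvec (s : Sh) (rest : List Sh) : B8 :=
  let tb := headB (sufMax rest)
  ⟨bmax s tb 0, bmax s tb 1, bmax s tb 2, bmax s tb 3, bmax s tb 4, bmax s tb 5, bmax s tb 6, bmax s tb 7⟩

/-- one step of the decoration -/
theorem sufMax_cons (s : Sh) (rest : List Sh) : sufMax (s :: rest) = (s, bvec s rest) :: sufMax rest := by
  simp only [sufMax, seqN_eq, bvec]

/-- components of the head vector -/
theorem bvec_get (s : Sh) (rest : List Sh) (k : ℕ) :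
    (bvec s rest).get k = bmax s (headB (sufMax rest)) (min k 7) := by
  rcases Nat.lt_or_ge k 7 with hk | hk
  · interval_cases k <;> rfl
  · rw [B8.get_ge7 _ hk, min_eq_right hk]; rfl

/-- the head vector dominates the ratio of every later shape whose volume fits the bucket -/
theorem sufMax_dom : ∀ (R : List Sh) (t : Sh), t ∈ R → ∀ k, capOK k t.V = true →
    t.rho ≤ (headB (sufMax R)).get k
  | [], t, ht, _, _ => absurd ht List.not_mem_nil
  | s :: rest, t, ht, k, hk => by
    rw [sufMax_cons]; simp only [headB]
    rw [bvec_get]; unfold bmax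
    rcases List.mem_cons.mp ht with rfl | ht'
    · rw [← capOK_min7] at hk; rw [if_pos hk]; exact le_max_left _ _
    · exact (sufMax_dom rest t ht' (min k 7) (by rwa [capOK_min7])).trans (le_max_right _ _)

end decoration

section universe_lemmas
/-! ### The universe: well-formed, inside `InUniv`, complete -/

variable {M : ℕ}

/-- the generated universe is well formed and inside `InUniv` -/
theorem mem_univ0 {t : Sh} (ht : t ∈ univ0 M) : t = shOf M t.tr ∧ InUniv M t.tr := by
  unfold univ0 at ht
  simp only [List.mem_flatMap, List.mem_filterMap, List.mem_range, Sh.force_eq,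
    Option.ite_none_right_eq_some, Option.some.injEq] at ht
  obtain ⟨a', -, b', -, c', -, hin, rfl⟩ := ht
  exact ⟨rfl, hin⟩

/-- **Completeness** of the generated universe -/
theorem shOf_mem_univ0 {x : ℕ × ℕ × ℕ} (hx : InUniv M x) : shOf M x ∈ univ0 M := by
  obtain ⟨ha, hb, hc⟩ := hx.pos
  have hv := hx.vol_le
  have hab : x.2.1 * x.1 ≤ M := by
    have h1 := hx.pab_le_vol; unfold pab vol at *
    have : x.1 * x.2.1 * x.2.2 ≤ M := le_trans (Nat.le_add_right _ _) hv
    nlinarith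
  have habc : x.2.2 * (x.1 * x.2.1) ≤ M := by
    unfold vol at hv
    have e : x.2.2 * (x.1 * x.2.1) = x.1 * x.2.1 * x.2.2 := by ring
    have := Nat.le_add_right (x.1 * x.2.1 * x.2.2) (max x.1 (max x.2.1 x.2.2))
    rw [e]; exact this.trans hv
  unfold univ0
  simp only [List.mem_flatMap, List.mem_filterMap, List.mem_range, Sh.force_eq,
    Option.ite_none_right_eq_some, Option.some.injEq]
  refine ⟨x.1 - 1, by have := hx.a_le; omega, x.2.1 - 1, ?_, x.2.2 - 1, ?_, ?_, ?_⟩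
  · rw [Nat.sub_add_cancel ha]
    exact Nat.lt_of_lt_of_le (Nat.sub_lt hb one_pos) ((Nat.le_div_iff_mul_le ha).mpr hab)
  · rw [Nat.sub_add_cancel ha, Nat.sub_add_cancel hb]
    exact Nat.lt_of_lt_of_le (Nat.sub_lt hc one_pos) ((Nat.le_div_iff_mul_le (Nat.mul_pos ha hb)).mpr habc)
  · rw [Nat.sub_add_cancel ha, Nat.sub_add_cancel hb, Nat.sub_add_cancel hc]; exact hx
  · rw [Nat.sub_add_cancel ha, Nat.sub_add_cancel hb, Nat.sub_add_cancel hc]; rfl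

/-- ratio levels are below `64` -/
theorem shOf_lev_lt (x : ℕ × ℕ × ℕ) : (shOf M x).lev < 64 :=
  Nat.lt_succ_of_le (min_le_left _ _)

/-- `addBin` keeps the number of bins -/
theorem addBin_length : ∀ (bs : List (List Sh)) (n : ℕ) (s : Sh), (addBin bs n s).length = bs.length
  | [], _, _ => rfl
  | _ :: _, 0, _ => rfl
  | b :: bs, n + 1, s => by simp [addBin, addBin_length bs n s]

/-- what `addBin` can contain -/
theorem mem_addBin : ∀ (bs : List (List Sh)) (n : ℕ) (s x : Sh),
    x ∈ (addBin bs n s).flatten → x = s ∨ x ∈ bs.flatten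
  | [], _, _, _, h => Or.inr h
  | b :: bs, 0, s, x, h => by
    simp only [addBin, List.flatten_cons, List.mem_append, List.mem_cons] at h ⊢; tauto
  | b :: bs, n + 1, s, x, h => by
    simp only [addBin, List.flatten_cons, List.mem_append] at h ⊢
    rcases h with h | h
    · exact Or.inr (Or.inl h)
    · rcases mem_addBin bs n s x h with h | h
      · exact Or.inl h
      · exact Or.inr (Or.inr h)

/-- `addBin` keeps earlier elements -/
theorem mem_addBin_of_mem : ∀ (bs : List (List Sh)) (n : ℕ) (s x : Sh),
    x ∈ bs.flatten → x ∈ (addBin bs n s).flatten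
  | [], _, _, _, h => h
  | b :: bs, 0, s, x, h => by
    simp only [addBin, List.flatten_cons, List.mem_append, List.mem_cons] at h ⊢; tauto
  | b :: bs, n + 1, s, x, h => by
    simp only [addBin, List.flatten_cons, List.mem_append] at h ⊢
    rcases h with h | h
    · exact Or.inl h
    · exact Or.inr (mem_addBin_of_mem bs n s x h)

/-- `addBin` files the new element when the bin exists -/
theorem self_mem_addBin : ∀ (bs : List (List Sh)) (n : ℕ) (s : Sh),
    n < bs.length → s ∈ (addBin bs n s).flatten
  | [], _, _, h => absurd h (Nat.not_lt_zero _)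
  | b :: bs, 0, s, _ => by simp [addBin]
  | b :: bs, n + 1, s, h => by
    simp only [addBin, List.flatten_cons, List.mem_append]
    exact Or.inr (self_mem_addBin bs n s (by simpa using h))

/-- the binned universe contains nothing new -/
theorem fold_sub (l : List Sh) : ∀ (acc : List (List Sh)) (x : Sh),
    x ∈ (l.foldl (fun bs s => addBin bs s.lev s) acc).flatten → x ∈ acc.flatten ∨ x ∈ l := by
  induction l with
  | nil => intro acc x h; exact Or.inl h
  | cons s l ih =>
    intro acc x h
    simp only [List.foldl_cons] at h
    rcases ih _ x h with h | h
    · rcases mem_addBin acc s.lev s x h with h | h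
      · exact Or.inr (by simp [h])
      · exact Or.inl h
    · exact Or.inr (List.mem_cons_of_mem _ h)

/-- the binned universe loses nothing -/
theorem fold_complete (l : List Sh) : ∀ (acc : List (List Sh)) (x : Sh),
    (∀ s ∈ l, s.lev < acc.length) → (x ∈ acc.flatten ∨ x ∈ l) →
    x ∈ (l.foldl (fun bs s => addBin bs s.lev s) acc).flatten := by
  induction l with
  | nil => intro acc x _ h; simpa using h
  | cons s l ih =>
    intro acc x hl h
    simp only [List.foldl_cons]
    apply ih
    · intro s' hs'; rw [addBin_length]; exact hl s' (List.mem_cons_of_mem _ hs')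
    · rcases h with h | h
      · exact Or.inl (mem_addBin_of_mem _ _ _ _ h)
      · rcases List.mem_cons.mp h with rfl | h
        · exact Or.inl (self_mem_addBin _ _ _ (hl _ (by simp)))
        · exact Or.inr h

/-- the ordered universe is well formed and inside `InUniv` -/
theorem mem_univ {t : Sh} (ht : t ∈ univ M) : t = shOf M t.tr ∧ InUniv M t.tr := by
  unfold univ bins at ht
  rw [List.mem_flatten] at ht
  obtain ⟨b, hb, htb⟩ := ht
  rw [List.mem_reverse] at hb
  have : t ∈ ((univ0 M).foldl (fun bs s => addBin bs s.lev s) (List.replicate 64 [])).flatten :=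
    List.mem_flatten.mpr ⟨b, hb, htb⟩
  rcases fold_sub _ _ _ this with h | h
  · simp at h
  · exact mem_univ0 h

/-- the ordered universe is well formed -/
theorem univ_wf (M : ℕ) : WfL M (univ M) := fun _ ht => (mem_univ ht).1

/-- the ordered universe lies inside `InUniv` -/
theorem univ_inUniv (M : ℕ) : ∀ t ∈ univ M, InUniv M t.tr := fun _ ht => (mem_univ ht).2

/-- **Completeness** of the ordered universe -/
theorem shOf_mem_univ {x : ℕ × ℕ × ℕ} (hx : InUniv M x) : shOf M x ∈ univ M := by
  have h0 := shOf_mem_univ0 hx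
  have : shOf M x ∈ ((univ0 M).foldl (fun bs s => addBin bs s.lev s) (List.replicate 64 [])).flatten := by
    apply fold_complete
    · intro s hs; rw [List.length_replicate, (mem_univ0 hs).1]; exact shOf_lev_lt _
    · exact Or.inr h0
  unfold univ bins
  obtain ⟨b, hb, hsb⟩ := List.mem_flatten.mp this
  exact List.mem_flatten.mpr ⟨b, List.mem_reverse.mpr hb, hsb⟩

end universe_lemmas

end Summit.MatrixMultiplication.MatrixMultiplication.Theorems.ShapeCert
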